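/-
Copyright (c) 2026 the pub-hodgecm-mathlib formalisation cell (harness21).  Prover seat hodgecm-mathlib-LH4-p08 (g10), req620 Track A «(D-RAM) FOUR-FRAME» squad, helper lane
on h413 = stmt-HodgeConjecture-24833 (count-neutral).  β sub-dealer LH4-p05 (g8) LEDGER #13: ROW R6 «SPECIAL κ-CLASSES», half (R6b) «THE κ-CLASS FAMILY SUM ∕ TELESCOPING TOTAL
INTO `restTarget`'s κ-COMPONENT».  2026-09-04.
-/
import Summits.HodgeConjecture.HodgeConjecture.Theorems.F0P3cDyRamOddLabelledBoxSumArith   -- ★ p861275 (LH4-p08 (g9)): `sum_pow_mul_bracket` (the bracketed telescope)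
import HarnessLib

/-!
# Crux `H413`, line LH4 «(D-RAM) FOUR-FRAME» — (β) table, β-BOARD row R6 (R6b): THE s-LINE TOTAL OF THE SPECIAL TOWER'S κ-CLASSES — the telescope
# `Σ_{s even} c·x^{e+s∕2}·F(n − ℓ − 2ρ − s) = −[2d + ℓ + 2ρ ≤ n]·c·x^{e+1}` (pure arithmetic in any commutative ring)

Cell `hodgecm-mathlib` (D-0151), FLOOR 0, crux item H413 = `stmt-HodgeConjecture-24833`, route `HCCMUnconditional`; squad F0∕P3c∕LH4; helper lane
`--supports stmt-HodgeConjecture-24833 --as helper` (count-neutral).  THEOREMS ONLY (no `def`, no instance, no notation, no `sorry`; default heartbeats); PURE ARITHMETIC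
(no field, no place, no lattice).

WHY.  In the `hRest` glue of the (β) table (★ p861451 `…OddLabelledRestReindex.sum_box_restShape_eq_of_rows` ED. 2, F0P3a-p01 (g37); ★ p861629 `…OddLabelledRestLines.sum_sum_ite_dirac_rho`,
LH4-p10 (g6)) the rest-glued double sum of the SPECIAL tower `X*` (doubled leg `m = 2ρ⋆ + ℓ₀`, `s_g = n_{X*} − m`) collapses to ONE s-line at `ρ⋆`: the κ-CLASSES `(ρ⋆, s)`,
`2 ≤ s ≤ s_g − 2` even (LH4-cdis1 (g0) KAPPA-CLASS-RULE v1 9469d3b1; R6-DERIVATION v1 06cc9a72 of this seat).  Their per-class value in the own slot is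
`c·x^{e + s∕2}·F(n_{X*} − ℓ₀ − 2ρ⋆ − s)` with the (T1) bracket `F(D) = (x − 1)·[2d ≤ D] − [D + 2 = 2d]` spelt `(if 2d + ℓ₀ + 2ρ⋆ + s ≤ n then x − 1 else 0) − (if n + 2 = 2d + ℓ₀ + 2ρ⋆ + s
then 1 else 0)` (`c = ω(−1)ω(e_B)∕2`, `x = q`, and `e = 2ρ⋆ − 1` in the lattice reading of R6-DERIVATION v1 §5 = fork (a) of g37 15:35:32Z; the lemma is generic in `c, x, e`, so the
literal q-reading `e = 2ρ⋆ − 2` is served too).  THIS FILE is the s-LINE TOTAL the `harith` step 2 consumes: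
* §1 `sum_Icc_ite_even_eq_sum_Icc_half` — `Σ_{s ∈ Icc 1 S} [2 ∣ s]·g s = Σ_{σ ∈ Icc 1 (S∕2)} g(2σ)`; `sum_Icc_ite_and_eq_of_vanish` — an extra conjunct `Q s` in the rest bracket
  (the socket's `¬cap`, the dispatcher's off-foot `n_{X*} ≠ m + s`) may be dropped when the summand vanishes wherever `Q` fails (it does: §2 `bracket_eq_zero_on_foot`).
* §2 `bracket_eq_zero_on_foot` — ON the glue foot `2ρ + s + ℓ = n` the bracket is `0` (`d ≥ 2`); `bracket_eq_zero_above` — above the read it is `0`;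
  **`kappaClass_line_total`** — for `d ≥ 2`, `n ≡ ℓ (mod 2)` and `n ≤ 2ρ + ℓ + S + 2` (the line `1 ≤ s ≤ S` reaches the last κ-class):
  `Σ_{s ∈ Icc 1 S} [2 ∣ s]·c·x^{e+s∕2}·F = if 2d + ℓ + 2ρ ≤ n then −(c·x^{e+1}) else 0` — ★ `sum_pow_mul_bracket` at `(l, M, P) := (ℓ + 2ρ, S∕2, (n − ℓ − 2ρ − 2d)∕2)` when the
  flip class exists (`min = P`, the `x^P` terms cancel, the total is the `−1`), and termwise `0` otherwise.
So with `e = 2ρ⋆ − 1`, `x = q`: `vK = −ω(−1)ω(e_B)∕2 · q^{m−ℓ₀} · [s_g ≥ 2d] = −A·(q∕2)·[s_g ≥ 2d]`, `A = ω(−1)ω(e_B)·q^{m−ℓ₀−1}` — the κ family total of R6-DERIVATION v1 §5.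
HONEST LABEL.  Count-neutral pure arithmetic; the per-class VALUE is the lattice head's (R6a LH4-p11 (g9) + orbit sums), not asserted here; R6∕hRest∕(β)∕T₊ OPEN; `HC_CM` is proved
only modulo the 7 printed citations (2 remaining named inputs: hLiu418 = `stmt-HodgeConjecture-24832`, h413 = `stmt-HodgeConjecture-24833`) until rung 0 closes.

## References
* [Kottwitz1986BaseChangeUnits] R. E. Kottwitz, *Base change for unit elements of Hecke algebras*, Compositio Math. 60 (1986), §1 pp. 240–241 (signed lattice counts by torus orbits — the sums being re-indexed).
* [Rogawski1990] J. D. Rogawski, *Automorphic Representations of Unitary Groups in Three Variables*, Ann. of Math. Stud. 123 (1990), §4.9 Prop. 4.9.1 (a)(b) p. 55 (the geometric-series shape of the orbit counts).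
-/

set_option autoImplicit false

open Finset
open Summit.HodgeConjecture.HodgeConjecture.Cruxes.H413.F0P3cDyRamOddLabelledBoxSumArith (sum_pow_mul_bracket)

namespace Summit.HodgeConjecture.HodgeConjecture.Cruxes.H413.F0P3cDyRamKappaClassLineTotal

section Reindex

variable {R : Type*} [AddCommMonoid R]

/-- **Even re-indexing of an `Icc` sum**: `Σ_{s ∈ Icc 1 S} [2 ∣ s]·g s = Σ_{σ ∈ Icc 1 (S∕2)} g(2σ)`. [folklore] -/
theorem sum_Icc_ite_even_eq_sum_Icc_half (g : ℕ → R) (S : ℕ) :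
    ∑ s ∈ Icc 1 S, (if 2 ∣ s then g s else 0) = ∑ σ ∈ Icc 1 (S / 2), g (2 * σ) := by
  classical
  induction S with
  | zero => simp
  | succ S ih =>
    rw [Finset.sum_Icc_succ_top (by omega), ih]
    by_cases h : 2 ∣ S + 1
    · rw [if_pos h, show (S + 1) / 2 = S / 2 + 1 by omega, Finset.sum_Icc_succ_top (by omega), show 2 * (S / 2 + 1) = S + 1 by omega]
    · rw [if_neg h, add_zero, show (S + 1) / 2 = S / 2 by omega]

/-- **An idle conjunct in the rest bracket may be dropped**: if the summand vanishes at every even `s ≤ S` where `Q` fails, then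
`Σ_{s ∈ Icc 1 S} [2 ∣ s ∧ Q s]·f s = Σ_{s ∈ Icc 1 S} [2 ∣ s]·f s`. [folklore] -/
theorem sum_Icc_ite_and_eq_of_vanish (f : ℕ → R) (Q : ℕ → Prop) [DecidablePred Q] (S : ℕ)
    (hQ : ∀ s, 1 ≤ s → s ≤ S → 2 ∣ s → ¬ Q s → f s = 0) :
    ∑ s ∈ Icc 1 S, (if 2 ∣ s ∧ Q s then f s else 0) = ∑ s ∈ Icc 1 S, (if 2 ∣ s then f s else 0) := by
  refine Finset.sum_congr rfl fun s hs => ?_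
  simp only [Finset.mem_Icc] at hs
  by_cases h2 : 2 ∣ s
  · by_cases hq : Q s
    · rw [if_pos ⟨h2, hq⟩, if_pos h2]
    · rw [if_neg (fun h => hq h.2), if_pos h2, hQ s hs.1 hs.2 h2 hq]
  · rw [if_neg (fun h => h2 h.1), if_neg h2]

end Reindex

section LineTotal

variable {R : Type*} [CommRing R]

/-- **ON THE GLUE FOOT THE BRACKET VANISHES**: at `2ρ + s + ℓ = n` (the glue class `s = s_g`, excluded by the dispatcher's off-foot conjunct) the κ-row formula reads
`F(0) = (x − 1)·[2d ≤ 0] − [2 = 2d] = 0` for `d ≥ 2` — so the off-foot conjunct is idle for the line total. [folklore] -/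
theorem bracket_eq_zero_on_foot (x : R) {d l n ρ s : ℕ} (hd : 2 ≤ d) (hfoot : 2 * ρ + s + l = n) :
    ((if 2 * d + l + 2 * ρ + s ≤ n then x - 1 else 0) - (if n + 2 = 2 * d + l + 2 * ρ + s then (1 : R) else 0)) = 0 := by
  rw [if_neg (by omega), if_neg (by omega), sub_zero]

/-- **ABOVE THE READ THE BRACKET VANISHES**: for `n < 2ρ + s + l` (no `T`-stable member there) the κ-row formula is `0` as well (`d ≥ 1`). [folklore] -/
theorem bracket_eq_zero_above (x : R) {d l n ρ s : ℕ} (hd : 1 ≤ d) (habove : n < 2 * ρ + s + l) :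
    ((if 2 * d + l + 2 * ρ + s ≤ n then x - 1 else 0) - (if n + 2 = 2 * d + l + 2 * ρ + s then (1 : R) else 0)) = 0 := by
  rw [if_neg (by omega), if_neg (by omega), sub_zero]

/-- **THE s-LINE TOTAL OF THE κ-CLASSES (R6b).**  For `d ≥ 2`, `n ≡ ℓ (mod 2)` and `n ≤ 2ρ + ℓ + S + 2` (the line `1 ≤ s ≤ S` reaches the last κ-class `s = s_g − 2`,
`s_g = n − ℓ − 2ρ`; an empty κ-range `s_g ≤ 2` is allowed — then both sides vanish):
`Σ_{s ∈ Icc 1 S} [2 ∣ s]·c·x^{e+s∕2}·((x − 1)·[2d + ℓ + 2ρ + s ≤ n] − [n + 2 = 2d + ℓ + 2ρ + s]) = −[2d + ℓ + 2ρ ≤ n]·c·x^{e+1}`: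
when the flip class `s = s_g − 2d + 2` exists (`s_g ≥ 2d`) the pure classes `s ≤ s_g − 2d` telescope to `c·x^{e+1}·(x^{P} − 1)` and the flip class subtracts `c·x^{e+1}·x^{P}`
(★ `sum_pow_mul_bracket`), leaving `−c·x^{e+1}`; otherwise every bracket is `0`. [folklore] -/
theorem kappaClass_line_total (x c : R) {d l n ρ S : ℕ} (e : ℕ) (hd : 2 ≤ d) (hpar : n % 2 = l % 2) (hS : n ≤ 2 * ρ + l + S + 2) :
    ∑ s ∈ Icc 1 S, (if 2 ∣ s then
        c * x ^ (e + s / 2) * ((if 2 * d + l + 2 * ρ + s ≤ n then x - 1 else 0) - (if n + 2 = 2 * d + l + 2 * ρ + s then (1 : R) else 0))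
      else 0) =
      if 2 * d + l + 2 * ρ ≤ n then -(c * x ^ (e + 1)) else 0 := by
  rw [sum_Icc_ite_even_eq_sum_Icc_half]
  by_cases hflip : 2 * d + l + 2 * ρ ≤ n
  · rw [if_pos hflip]
    -- the flip class exists: `2P + 2d + (l + 2ρ) = n`, `P + 1 ≤ S∕2`
    obtain ⟨P, hP⟩ : ∃ P, 2 * P + 2 * d + (l + 2 * ρ) = n := ⟨(n - l - 2 * ρ - 2 * d) / 2, by omega⟩
    have hre : ∀ σ ∈ Icc 1 (S / 2),
        c * x ^ (e + 2 * σ / 2) * ((if 2 * d + l + 2 * ρ + 2 * σ ≤ n then x - 1 else 0) - (if n + 2 = 2 * d + l + 2 * ρ + 2 * σ then (1 : R) else 0)) =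
          c * x ^ (e + 1) * (x ^ (σ - 1) *
            ((if 2 * d + (l + 2 * ρ) + 2 * σ ≤ n then x - 1 else 0) - (if n + 2 = 2 * d + (l + 2 * ρ) + 2 * σ then (1 : R) else 0))) := by
      intro σ hσ
      simp only [Finset.mem_Icc] at hσ
      rw [show e + 2 * σ / 2 = (e + 1) + (σ - 1) by omega, pow_add, show 2 * d + l + 2 * ρ + 2 * σ = 2 * d + (l + 2 * ρ) + 2 * σ by ring]
      ring
    rw [Finset.sum_congr rfl hre, ← Finset.mul_sum, sum_pow_mul_bracket x hP, min_eq_right (by omega : P ≤ S / 2), if_pos (by omega : P + 1 ≤ S / 2)]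
    ring
  · rw [if_neg hflip]
    refine Finset.sum_eq_zero fun σ hσ => ?_
    simp only [Finset.mem_Icc] at hσ
    rw [if_neg (by omega), if_neg (by omega), sub_zero, mul_zero]

/-- **THE s-LINE TOTAL WITH THE REST BRACKET'S EXTRA CONJUNCT** (the shape ★ p861629 `sum_sum_ite_dirac_rho` leaves: `[2 ∣ s ∧ Q s]` with `Q s` the socket's `¬cap`
and∕or the dispatcher's off-foot `2ρ + s + ℓ ≠ n`): if `Q` can only fail, among the even `s ≤ S`, ON the foot `2ρ + s + ℓ = n`, the total is the same
`−[2d + ℓ + 2ρ ≤ n]·c·x^{e+1}`. [folklore] -/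
theorem kappaClass_line_total_of_offFoot (x c : R) {d l n ρ S : ℕ} (e : ℕ) (hd : 2 ≤ d) (hpar : n % 2 = l % 2)
    (hS : n ≤ 2 * ρ + l + S + 2) (Q : ℕ → Prop) [DecidablePred Q]
    (hQ : ∀ s, 1 ≤ s → s ≤ S → 2 ∣ s → ¬ Q s → 2 * ρ + s + l = n) :
    ∑ s ∈ Icc 1 S, (if 2 ∣ s ∧ Q s then
        c * x ^ (e + s / 2) * ((if 2 * d + l + 2 * ρ + s ≤ n then x - 1 else 0) - (if n + 2 = 2 * d + l + 2 * ρ + s then (1 : R) else 0))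
      else 0) =
      if 2 * d + l + 2 * ρ ≤ n then -(c * x ^ (e + 1)) else 0 := by
  rw [sum_Icc_ite_and_eq_of_vanish _ Q S (fun s h1 hS' h2 hq => by rw [bracket_eq_zero_on_foot x hd (hQ s h1 hS' h2 hq), mul_zero]),
    kappaClass_line_total x c e hd hpar hS]

end LineTotal

end Summit.HodgeConjecture.HodgeConjecture.Cruxes.H413.F0P3cDyRamKappaClassLineTotal
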